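import Literature.Analysis.DeBrangesSpaces.ConreyLi2000SpacesFWProofs
import Literature.Analysis.DeBrangesSpaces.HardyPaleyWiener
import HarnessLib

/-!
# Conrey–Li 2000, (2.6): the kernel `K(w, z)` reproduces every element of `𝓕(W)` — PROVED

LABEL (line 1): RH-FREE; theorems about the GENERAL spaces `𝓕(W)` of
`Literature/Analysis/DeBrangesSpaces/ConreyLi2000SpacesFW.lean` (Conrey–Li's definition as typed:
`SpaceF.Mem`, `SpaceF.inner`, `SpaceF.kernel`), no definitions, no named facts. bears_on: B-C/B-P
(LADDER-RH §1, COLUMN 6 DBR). WHAT THIS IS NOT: not progress toward RH — de Branges' positivity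
hypothesis FAILS for `W = 1/ξ(1 − iz)` and every `W_χ` (Conrey–Li §3–§4; tree
`Literature.Barriers.RiemannHypothesis.ConreyLi2000_FW_holds`, `not_positivity_spaceF_zeta_holds`);
proving that the typed space reproduces its kernel is transcription fidelity of Conrey–Li §2;
nothing here bears on the truth of RH.

J. B. Conrey, X.-J. Li, IMRN 2000:18 = arXiv:math/9812166, §2 (arXiv p. 2, lines 52–58 of the held
text `paper:arxiv-math_9812166` p0002):

> The reproducing kernel function of `𝓕(W)` is given by the expression
> `K(w, z) = W(z) W̄(w) / (2πi(w̄ − z))`, that is, for every complex `w` in the upper half-plane,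
> we have `F(w) = ⟨F(z), K(w, z)⟩_{𝓕(W)}` (2.6) for every element `F ∈ 𝓕(W)`.

The companion files type `𝓕(W)` as printed (`ConreyLi2000SpacesFW.lean`: "Its reproducing
property … is Conrey–Li's (2.6), not proved here") and prove (2.6) for the kernels `F = K(w′, ·)`
only (`ConreyLi2000SpacesFWProofs.lean`, `SpaceF.inner_kernel_kernelShift`). Here (2.6) is proved
for EVERY element of the typed space.

## What is proved

For `W` analytic and zero-free on the open upper half-plane, `F ∈ 𝓕(W)` (`SpaceF.Mem W F`) and
`Im w > 0`:

* `SpaceF.inner_kernel_eq_apply` — **(2.6)**: `SpaceF.inner W F (SpaceF.kernel W w) = F w`.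
* `SpaceF.cauchy_integral_of_mem`, `SpaceF.apply_eq_cauchy_integral`,
  `SpaceF.cauchy_integral_eq_zero_of_im_neg` — the Cauchy representation behind it: with
  `b = bdryValue (F/W)` (a.e. vertical boundary values, in `L²(ℝ)` by membership),
  `∫ b(t)/(t − w) dt = 2πi F(w)/W(w)` for `Im w > 0` and `∫ b(t)/(t − a) dt = 0` for `Im a < 0`.
* `SpaceF.norm_sq_apply_le` — the reproducing-kernel bound `|F(w)|² ≤ ⟨F,F⟩ K(w,w)` in the
  explicit form `‖F(w)‖² ≤ (∫‖b‖²) ‖W(w)‖²/(4π Im w)`.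

The analytic engine (`cauchy_integral_of_logMajorant`, stated for any `g` holomorphic on the open
upper half-plane with a.e. vertical boundary values `b ∈ L²(ℝ)` and Conrey–Li's membership
inequality `log|g(x+iy)| ≤ (y/π)∫ log|b(t)| dt/((t−x)²+y²)`, `HasPoissonLogMajorant g`; the
bounded-type clause of the printed definition is not used):

1. `norm_le_one_add_poisson_of_logMajorant` — Jensen's step: `‖g(x+iy)‖ ≤ 1 + (y/π)∫‖b‖/((t−x)²+y²)`
   (concavity of `log` in tangent-line form; Lean's `log 0 = 0` is absorbed by `log s ≤ log(1+s)`).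
2. `hardy_bound_of_logMajorant` — `G = g/(z+i)` is in `H²`: `∫‖G(x+iy)‖²dx ≤ 2π + 2∫‖b‖²`
   (variance inequality `sq_poisson_norm_le` and Tonelli `integral_poisson_norm_sq` for the
   Poisson weight).
3. Cauchy's theorem/formula along `ℝ` for the boundary-regular translates `G(· + iε)` (tree
   `HalfPlaneCauchy`, hypotheses supplied by `HardyPaleyWiener.translate_hypotheses_of_hardy`).
4. `tendsto_integral_mul_of_norm_sq_le` — the limit `ε → 0⁺` under `∫ · k`, `k ∈ L²`: a.e.
   convergence (the vertical limits `HasBdryValues`) with a uniform `L²` bound passes to the limit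
   by Vitali's convergence theorem (Mathlib `tendsto_Lp_of_tendsto_ae`) for the uniformly
   integrable, tight family `G(· + iε_n) k`.
5. Partial fractions `1/((t+i)(t−c)) = (1/(c+i))(1/(t−c) − 1/(t+i))` and
   `∫ b/(t + iR) → 0` (`R → ∞`, dominated convergence) remove the auxiliary factor `1/(z+i)`.

## References

* [ConreyLi2000] J. B. Conrey, X.-J. Li, IMRN 2000:18, 929–940 = arXiv:math/9812166, §2, the
  space `𝓕(W)` and (2.6) (read, arXiv p. 2).
* [Rudin1987] W. Rudin, *Real and Complex Analysis*, 3rd ed., Thm 17.16 / §17.20 (Poisson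
  log-majorant, Jensen) and Thm 19.2 with §19.1 (the `H²` of a half-plane: boundary values and
  Cauchy/Laplace representation). All statements in sections A–D are folklore.
-/

noncomputable section

open scoped Real Topology ComplexConjugate ENNReal
open _root_.Complex _root_.MeasureTheory _root_.Filter _root_.Set

namespace Literature.Analysis.DeBrangesSpaces

/-! ## A. The Poisson weight `((t − x)² + y²)⁻¹` against `L²` boundary functions; Jensen's step -/

section Poisson

variable {x y : ℝ}

/-- `(t − x)² + y² > 0` for `y ≠ 0`. [folklore] -/
private theorem qpos (x : ℝ) (hy : y ≠ 0) (t : ℝ) : 0 < (t - x) ^ 2 + y ^ 2 := by positivity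

/-- `((t − x)² + y²)⁻¹ ≤ y⁻²`. [folklore] -/
private theorem inv_q_le (x : ℝ) (hy : y ≠ 0) (t : ℝ) : ((t - x) ^ 2 + y ^ 2)⁻¹ ≤ (y ^ 2)⁻¹ := by
  have hy2 : 0 < y ^ 2 := by positivity
  exact inv_anti₀ hy2 (by nlinarith [sq_nonneg (t - x)])

/-- The Poisson weight is square integrable: `t ↦ ((t − x)² + y²)⁻¹ ∈ L²(ℝ)` (`y ≠ 0`).
[folklore] -/
private theorem memLp_two_inv_sub_sq_add_sq (x : ℝ) (hy : y ≠ 0) :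
    MemLp (fun t : ℝ ↦ ((t - x) ^ 2 + y ^ 2)⁻¹) 2 volume := by
  have hcont : Continuous fun t : ℝ ↦ ((t - x) ^ 2 + y ^ 2)⁻¹ :=
    Continuous.inv₀ (by fun_prop) fun t ↦ (qpos x hy t).ne'
  rw [memLp_two_iff_integrable_sq_norm hcont.aestronglyMeasurable]
  refine ((integrable_inv_sub_sq_add_sq x hy).const_mul (y ^ 2)⁻¹).mono'
    (hcont.norm.pow 2).aestronglyMeasurable (ae_of_all _ fun t ↦ ?_)
  have hq := qpos x hy t
  rw [Real.norm_eq_abs, abs_of_nonneg (by positivity), Real.norm_eq_abs,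
    abs_of_pos (inv_pos.2 hq), sq]
  exact mul_le_mul_of_nonneg_right (inv_q_le x hy t) (inv_pos.2 hq).le

/-- An `L²` function against the Poisson weight is integrable:
`t ↦ h(t)/((t − x)² + y²) ∈ L¹(ℝ)` for `h ∈ L²(ℝ)`, `y ≠ 0`. [folklore] -/
private theorem integrable_div_sub_sq_add_sq_of_memLp {h : ℝ → ℝ} (hh : MemLp h 2 volume) (x : ℝ)
    (hy : y ≠ 0) : Integrable fun t : ℝ ↦ h t / ((t - x) ^ 2 + y ^ 2) := by
  have := MemLp.integrable_mul (memLp_two_inv_sub_sq_add_sq x hy) hh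
  refine this.congr (ae_of_all _ fun t ↦ ?_)
  simp [div_eq_inv_mul]

/-- The norm of an `L²(ℝ, ℂ)` function is in `L²(ℝ, ℝ)`. [folklore] -/
private theorem memLp_two_norm {b : ℝ → ℂ} (hb : MemLp b 2 volume) :
    MemLp (fun t : ℝ ↦ ‖b t‖) 2 volume := hb.norm

/-- A square-integrable `h ≥ 0`... the product `h² · ((t−x)²+y²)⁻¹` is integrable (`h ∈ L²`).
[folklore] -/
private theorem integrable_sq_div_sub_sq_add_sq_of_memLp {b : ℝ → ℂ} (hb : MemLp b 2 volume) (x : ℝ)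
    (hy : y ≠ 0) : Integrable fun t : ℝ ↦ ‖b t‖ ^ 2 / ((t - x) ^ 2 + y ^ 2) := by
  have h2 : Integrable fun t : ℝ ↦ ‖b t‖ ^ 2 := (memLp_two_iff_integrable_sq_norm hb.1).1 hb
  have hcont : Continuous fun t : ℝ ↦ ((t - x) ^ 2 + y ^ 2)⁻¹ :=
    Continuous.inv₀ (by fun_prop) fun t ↦ (qpos x hy t).ne'
  refine (h2.bdd_mul (c := (y ^ 2)⁻¹) hcont.aestronglyMeasurable
    (ae_of_all _ fun t ↦ ?_)).congr (ae_of_all _ fun t ↦ ?_)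
  · rw [Real.norm_eq_abs, abs_of_pos (inv_pos.2 (qpos x hy t))]
    exact inv_q_le x hy t
  · simp [div_eq_inv_mul]

/-- **Jensen's step for the Poisson log-majorant.** For `b ∈ L²(ℝ)`, `y > 0` and
`m = 1 + (y/π) ∫ ‖b(t)‖ dt/((t−x)²+y²)`:
`(y/π) ∫ log‖b(t)‖ dt/((t−x)²+y²) ≤ log m` whenever the left integrand is integrable
(concavity of `log` in the tangent-line form `log u ≤ log m + u/m − 1`; with Lean's `log 0 = 0`
one first bounds `log‖b‖ ≤ log(1 + ‖b‖)`). [folklore] -/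
private theorem poisson_log_le_log_one_add {b : ℝ → ℂ} (hb : MemLp b 2 volume) (x : ℝ) (hy : 0 < y)
    (hint : Integrable fun t : ℝ ↦ Real.log ‖b t‖ / ((t - x) ^ 2 + y ^ 2)) :
    y / π * ∫ t : ℝ, Real.log ‖b t‖ / ((t - x) ^ 2 + y ^ 2)
      ≤ Real.log (1 + y / π * ∫ t : ℝ, ‖b t‖ / ((t - x) ^ 2 + y ^ 2)) := by
  set A : ℝ := y / π * ∫ t : ℝ, ‖b t‖ / ((t - x) ^ 2 + y ^ 2) with hA
  have hyπ : 0 < y / π := div_pos hy Real.pi_pos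
  have hIb : Integrable fun t : ℝ ↦ ‖b t‖ / ((t - x) ^ 2 + y ^ 2) :=
    integrable_div_sub_sq_add_sq_of_memLp (memLp_two_norm hb) x hy.ne'
  have hA0 : 0 ≤ A :=
    mul_nonneg hyπ.le (integral_nonneg fun t ↦ div_nonneg (norm_nonneg _) (qpos x hy.ne' t).le)
  set m : ℝ := 1 + A with hm
  have hm1 : 1 ≤ m := by linarith
  have hm0 : 0 < m := by linarith
  -- pointwise: `log‖b t‖ ≤ log m − 1 + (1 + ‖b t‖)/m`
  have hpt : ∀ t : ℝ, Real.log ‖b t‖ ≤ Real.log m - 1 + (1 + ‖b t‖) / m := by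
    intro t
    have h1 : Real.log ‖b t‖ ≤ Real.log (1 + ‖b t‖) := by
      rcases (norm_nonneg (b t)).eq_or_lt with h0 | hpos
      · rw [← h0]; simp
      · exact Real.log_le_log hpos (by linarith)
    have h2 : Real.log ((1 + ‖b t‖) / m) ≤ (1 + ‖b t‖) / m - 1 :=
      Real.log_le_sub_one_of_pos (by positivity)
    rw [Real.log_div (by positivity) hm0.ne'] at h2
    linarith
  have hq : ∀ t : ℝ, 0 < (t - x) ^ 2 + y ^ 2 := qpos x hy.ne'
  have hptq : ∀ t : ℝ, Real.log ‖b t‖ / ((t - x) ^ 2 + y ^ 2)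
      ≤ (Real.log m - 1 + m⁻¹) * ((t - x) ^ 2 + y ^ 2)⁻¹
        + m⁻¹ * (‖b t‖ / ((t - x) ^ 2 + y ^ 2)) := by
    intro t
    have e : (Real.log m - 1 + m⁻¹) * ((t - x) ^ 2 + y ^ 2)⁻¹
        + m⁻¹ * (‖b t‖ / ((t - x) ^ 2 + y ^ 2))
        = (Real.log m - 1 + (1 + ‖b t‖) / m) / ((t - x) ^ 2 + y ^ 2) := by
      field_simp
      ring
    rw [e]
    exact div_le_div_of_nonneg_right (hpt t) (hq t).le
  have hR : Integrable fun t : ℝ ↦ (Real.log m - 1 + m⁻¹) * ((t - x) ^ 2 + y ^ 2)⁻¹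
      + m⁻¹ * (‖b t‖ / ((t - x) ^ 2 + y ^ 2)) :=
    ((integrable_inv_sub_sq_add_sq x hy.ne').const_mul _).add (hIb.const_mul _)
  have hle := integral_mono hint hR hptq
  rw [integral_add ((integrable_inv_sub_sq_add_sq x hy.ne').const_mul _) (hIb.const_mul _),
    integral_const_mul, integral_const_mul, integral_inv_sub_sq_add_sq x hy] at hle
  -- multiply by `y/π` and simplify
  have key : y / π * ((Real.log m - 1 + m⁻¹) * (π / y)
      + m⁻¹ * ∫ t : ℝ, ‖b t‖ / ((t - x) ^ 2 + y ^ 2)) = Real.log m := by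
    have hπ : (π : ℝ) ≠ 0 := Real.pi_ne_zero
    have hyne : y ≠ 0 := hy.ne'
    have hAm : y / π * ∫ t : ℝ, ‖b t‖ / ((t - x) ^ 2 + y ^ 2) = m - 1 := by rw [hm, hA]; ring
    calc y / π * ((Real.log m - 1 + m⁻¹) * (π / y) + m⁻¹ * ∫ t : ℝ, ‖b t‖ / ((t - x) ^ 2 + y ^ 2))
        = (Real.log m - 1 + m⁻¹) * (y / π * (π / y))
          + m⁻¹ * (y / π * ∫ t : ℝ, ‖b t‖ / ((t - x) ^ 2 + y ^ 2)) := by ring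
      _ = Real.log m := by
          rw [hAm, show y / π * (π / y) = 1 by field_simp]
          field_simp
          ring
  calc y / π * ∫ t : ℝ, Real.log ‖b t‖ / ((t - x) ^ 2 + y ^ 2)
      ≤ y / π * ((Real.log m - 1 + m⁻¹) * (π / y)
          + m⁻¹ * ∫ t : ℝ, ‖b t‖ / ((t - x) ^ 2 + y ^ 2)) :=
        mul_le_mul_of_nonneg_left hle hyπ.le
    _ = Real.log m := key

/-- **Pointwise bound from the Poisson log-majorant**: if `g` satisfies Conrey–Li's membership
inequality `log|g(x+iy)| ≤ (y/π)∫ log|b(t)| dt/((t−x)²+y²)` (`HasPoissonLogMajorant g`, `b` the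
boundary function) and `b ∈ L²(ℝ)`, then `‖g(x+iy)‖ ≤ 1 + (y/π)∫ ‖b(t)‖ dt/((t−x)²+y²)` for
`y > 0` — `|g|` is dominated by `1 +` the Poisson integral of `|b|`.
[cite: ConreyLi2000, §2 (definition of 𝓕(W))] -/
theorem norm_le_one_add_poisson_of_logMajorant {g : ℂ → ℂ} (hP : HasPoissonLogMajorant g)
    (hb : MemLp (bdryValue g) 2 volume) (x : ℝ) (hy : 0 < y) :
    ‖g (x + y * I)‖ ≤ 1 + y / π * ∫ t : ℝ, ‖bdryValue g t‖ / ((t - x) ^ 2 + y ^ 2) := by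
  have hA0 : 0 ≤ y / π * ∫ t : ℝ, ‖bdryValue g t‖ / ((t - x) ^ 2 + y ^ 2) :=
    mul_nonneg (div_pos hy Real.pi_pos).le
      (integral_nonneg fun t ↦ div_nonneg (norm_nonneg _) (qpos x hy.ne' t).le)
  by_cases h0 : g (x + y * I) = 0
  · rw [h0, norm_zero]; linarith
  obtain ⟨hint, hle⟩ := hP x y hy
  have h1 := (hle h0).trans (poisson_log_le_log_one_add hb x hy hint)
  have hpos : 0 < ‖g (x + y * I)‖ := norm_pos_iff.2 h0
  exact (Real.log_le_log_iff hpos (by linarith)).1 h1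

end Poisson

/-! ## B. The Hardy bound for `g(z)/(z + i)` -/

section Hardy

variable {y : ℝ}

/-- **Variance inequality for the Poisson weight**: for `b ∈ L²(ℝ)`, `y > 0`,
`((y/π)∫ ‖b‖/((t−x)²+y²))² ≤ (y/π)∫ ‖b‖²/((t−x)²+y²)` (the weight `(y/π)/((t−x)²+y²)` has total
mass `1`; expand `∫ (‖b‖ − A)² ≥ 0`). [folklore] -/
private theorem sq_poisson_norm_le {b : ℝ → ℂ} (hb : MemLp b 2 volume) (x : ℝ) (hy : 0 < y) :
    (y / π * ∫ t : ℝ, ‖b t‖ / ((t - x) ^ 2 + y ^ 2)) ^ 2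
      ≤ y / π * ∫ t : ℝ, ‖b t‖ ^ 2 / ((t - x) ^ 2 + y ^ 2) := by
  set A : ℝ := y / π * ∫ t : ℝ, ‖b t‖ / ((t - x) ^ 2 + y ^ 2) with hA
  have hq : ∀ t : ℝ, 0 < (t - x) ^ 2 + y ^ 2 := qpos x hy.ne'
  have hI1 : Integrable fun t : ℝ ↦ ‖b t‖ / ((t - x) ^ 2 + y ^ 2) :=
    integrable_div_sub_sq_add_sq_of_memLp (memLp_two_norm hb) x hy.ne'
  have hI2 : Integrable fun t : ℝ ↦ ‖b t‖ ^ 2 / ((t - x) ^ 2 + y ^ 2) :=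
    integrable_sq_div_sub_sq_add_sq_of_memLp hb x hy.ne'
  have hI0 : Integrable fun t : ℝ ↦ ((t - x) ^ 2 + y ^ 2)⁻¹ := integrable_inv_sub_sq_add_sq x hy.ne'
  -- `0 ≤ ∫ (‖b‖ − A)²/q = ∫‖b‖²/q − 2A∫‖b‖/q + A² π/y`
  have hnn : 0 ≤ ∫ t : ℝ, (‖b t‖ - A) ^ 2 / ((t - x) ^ 2 + y ^ 2) :=
    integral_nonneg fun t ↦ div_nonneg (sq_nonneg _) (hq t).le
  have hexp : ∀ t : ℝ, (‖b t‖ - A) ^ 2 / ((t - x) ^ 2 + y ^ 2)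
      = ‖b t‖ ^ 2 / ((t - x) ^ 2 + y ^ 2) - 2 * A * (‖b t‖ / ((t - x) ^ 2 + y ^ 2))
        + A ^ 2 * ((t - x) ^ 2 + y ^ 2)⁻¹ := by
    intro t
    field_simp
    ring
  simp_rw [hexp] at hnn
  rw [integral_add (hI2.sub' (hI1.const_mul _)) (hI0.const_mul _), integral_sub hI2 (hI1.const_mul _),
    integral_const_mul, integral_const_mul, integral_inv_sub_sq_add_sq x hy] at hnn
  -- multiply by `y/π > 0`
  have hyπ : 0 < y / π := div_pos hy Real.pi_pos
  have h := mul_nonneg hyπ.le hnn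
  have e1 : y / π * (π / y) = 1 := by
    have hπ : (π : ℝ) ≠ 0 := Real.pi_ne_zero
    have hyne : y ≠ 0 := hy.ne'
    field_simp
  have e : y / π * ((∫ t : ℝ, ‖b t‖ ^ 2 / ((t - x) ^ 2 + y ^ 2))
      - 2 * A * (∫ t : ℝ, ‖b t‖ / ((t - x) ^ 2 + y ^ 2)) + A ^ 2 * (π / y))
      = y / π * (∫ t : ℝ, ‖b t‖ ^ 2 / ((t - x) ^ 2 + y ^ 2)) - A ^ 2 := by
    calc y / π * ((∫ t : ℝ, ‖b t‖ ^ 2 / ((t - x) ^ 2 + y ^ 2))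
        - 2 * A * (∫ t : ℝ, ‖b t‖ / ((t - x) ^ 2 + y ^ 2)) + A ^ 2 * (π / y))
        = y / π * (∫ t : ℝ, ‖b t‖ ^ 2 / ((t - x) ^ 2 + y ^ 2))
          - 2 * A * (y / π * ∫ t : ℝ, ‖b t‖ / ((t - x) ^ 2 + y ^ 2))
          + A ^ 2 * (y / π * (π / y)) := by ring
      _ = y / π * (∫ t : ℝ, ‖b t‖ ^ 2 / ((t - x) ^ 2 + y ^ 2)) - A ^ 2 := by
          rw [← hA, e1]; ring
  rw [e] at h
  linarith

/-- **Tonelli for the Poisson weight**: for `b ∈ L²(ℝ)` and `y > 0`, the function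
`x ↦ (y/π)∫ ‖b(t)‖²/((t−x)²+y²) dt` is integrable on `ℝ` with integral `∫ ‖b‖²` (the weight has
mass `1` in `x` for each `t`). [folklore] -/
private theorem integral_poisson_norm_sq {b : ℝ → ℂ} (hb : MemLp b 2 volume) (hy : 0 < y) :
    Integrable (fun x : ℝ ↦ y / π * ∫ t : ℝ, ‖b t‖ ^ 2 / ((t - x) ^ 2 + y ^ 2)) ∧
      ∫ x : ℝ, (y / π * ∫ t : ℝ, ‖b t‖ ^ 2 / ((t - x) ^ 2 + y ^ 2)) = ∫ t : ℝ, ‖b t‖ ^ 2 := by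
  have hyne : y ≠ 0 := hy.ne'
  have hb2 : Integrable fun t : ℝ ↦ ‖b t‖ ^ 2 := (memLp_two_iff_integrable_sq_norm hb.1).1 hb
  -- the integrand on `ℝ × ℝ`, variables `(x, t)`
  set Φ : ℝ × ℝ → ℝ := fun p ↦ ‖b p.2‖ ^ 2 * ((p.2 - p.1) ^ 2 + y ^ 2)⁻¹ with hΦ
  have hΦm : AEStronglyMeasurable Φ (volume.prod volume) := by
    refine AEStronglyMeasurable.mul ?_ ?_
    · exact ((hb.1.norm.pow 2).comp_snd : AEStronglyMeasurable (fun p : ℝ × ℝ ↦ ‖b p.2‖ ^ 2) _)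
    · have hc : Continuous fun p : ℝ × ℝ ↦ ((p.2 - p.1) ^ 2 + y ^ 2)⁻¹ :=
        Continuous.inv₀ (by fun_prop) fun p ↦ (qpos p.1 hyne p.2).ne'
      exact hc.aestronglyMeasurable
  -- sections in `x` for fixed `t`: integral `‖b t‖² π/y`
  have hsec : ∀ t : ℝ, Integrable (fun x : ℝ ↦ Φ (x, t)) ∧
      ∫ x : ℝ, Φ (x, t) = ‖b t‖ ^ 2 * (π / y) := by
    intro t
    have h1 : (fun x : ℝ ↦ Φ (x, t)) = fun x ↦ ‖b t‖ ^ 2 * ((x - t) ^ 2 + y ^ 2)⁻¹ := by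
      funext x; simp only [hΦ]; rw [show (t - x) ^ 2 = (x - t) ^ 2 by ring]
    rw [h1]
    exact ⟨(integrable_inv_sub_sq_add_sq t hyne).const_mul _,
      by rw [integral_const_mul, integral_inv_sub_sq_add_sq t hy]⟩
  have hΦn : ∀ p : ℝ × ℝ, 0 ≤ Φ p := fun p ↦
    mul_nonneg (sq_nonneg _) (inv_pos.2 (qpos p.1 hyne p.2)).le
  have hΦi : Integrable Φ (volume.prod volume) := by
    rw [integrable_prod_iff' hΦm]
    refine ⟨ae_of_all _ fun t ↦ (hsec t).1, ?_⟩
    have e : (fun t : ℝ ↦ ∫ x : ℝ, ‖Φ (x, t)‖) = fun t ↦ ‖b t‖ ^ 2 * (π / y) := by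
      funext t
      rw [← (hsec t).2]
      exact integral_congr_ae (ae_of_all _ fun x ↦ Real.norm_of_nonneg (hΦn (x, t)))
    rw [e]
    exact hb2.mul_const _
  -- `x ↦ ∫_t Φ(x,t)` and its integral
  have hleft : Integrable (fun x : ℝ ↦ ∫ t : ℝ, Φ (x, t)) := hΦi.integral_prod_left
  have hswap : ∫ x : ℝ, ∫ t : ℝ, Φ (x, t) = ∫ t : ℝ, ∫ x : ℝ, Φ (x, t) := by
    rw [← integral_prod Φ hΦi, integral_prod_symm Φ hΦi]
  have hinner : ∀ x : ℝ, y / π * ∫ t : ℝ, ‖b t‖ ^ 2 / ((t - x) ^ 2 + y ^ 2)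
      = y / π * ∫ t : ℝ, Φ (x, t) := by
    intro x
    simp only [hΦ, div_eq_mul_inv]
  simp_rw [hinner]
  refine ⟨hleft.const_mul _, ?_⟩
  rw [integral_const_mul, hswap]
  simp_rw [(hsec _).2]
  rw [integral_mul_const]
  have hπ : (π : ℝ) ≠ 0 := Real.pi_ne_zero
  field_simp

/-- `‖x + iy + i‖² = x² + (y+1)²`. [folklore] -/
private theorem norm_sq_den (x y : ℝ) : ‖(x : ℂ) + y * I + I‖ ^ 2 = x ^ 2 + (y + 1) ^ 2 := by
  rw [← Complex.normSq_eq_norm_sq, Complex.normSq_apply]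
  simp
  ring

/-- Along a horizontal line `Im z = y > 0`, a function holomorphic on the open upper half-plane is
continuous in `x`. [folklore] -/
private theorem continuous_line_of_differentiableOn {G : ℂ → ℂ}
    (hG : DifferentiableOn ℂ G {z : ℂ | 0 < z.im}) (hy : 0 < y) :
    Continuous fun x : ℝ ↦ G (x + y * I) := by
  have hline : Continuous fun x : ℝ ↦ (x : ℂ) + y * I := by fun_prop
  refine hG.continuousOn.comp_continuous hline fun x ↦ ?_
  show 0 < ((x : ℂ) + y * I).im
  simpa using hy

/-- **The Hardy bound.** If `g` is holomorphic on the open upper half-plane, satisfies the Poisson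
log-majorant inequality, and its boundary function `b` is in `L²(ℝ)`, then `G(z) = g(z)/(z + i)`
belongs to `H²`: `∫_ℝ ‖G(x+iy)‖² dx ≤ 2π + 2∫‖b‖²` for every `y > 0`
(`‖g‖ ≤ 1 + P[‖b‖]`, `(1 + P[‖b‖])² ≤ 2 + 2P[‖b‖²]`, `|x + iy + i|² ≥ max(1, x²+1)`); the `H²`
condition of [Rudin1987, Thm 19.2] for the quotient class of Conrey–Li's definition.
[cite: ConreyLi2000, §2 (definition of 𝓕(W))] -/
theorem hardy_bound_of_logMajorant {g : ℂ → ℂ} (hg : DifferentiableOn ℂ g {z : ℂ | 0 < z.im})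
    (hP : HasPoissonLogMajorant g) (hb : MemLp (bdryValue g) 2 volume) (hy : 0 < y) :
    Integrable (fun x : ℝ ↦ ‖g (x + y * I) / ((x : ℂ) + y * I + I)‖ ^ 2) ∧
      ∫ x : ℝ, ‖g (x + y * I) / ((x : ℂ) + y * I + I)‖ ^ 2
        ≤ 2 * π + 2 * ∫ t : ℝ, ‖bdryValue g t‖ ^ 2 := by
  set b := bdryValue g with hbdef
  -- the dominating function
  set D : ℝ → ℝ := fun x ↦ 2 * (1 + x ^ 2)⁻¹
    + 2 * (y / π * ∫ t : ℝ, ‖b t‖ ^ 2 / ((t - x) ^ 2 + y ^ 2)) with hD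
  obtain ⟨hTi, hTeq⟩ := integral_poisson_norm_sq hb hy
  have hDi : Integrable D := (integrable_inv_one_add_sq.const_mul _).add (hTi.const_mul _)
  have hDint : ∫ x : ℝ, D x = 2 * π + 2 * ∫ t : ℝ, ‖b t‖ ^ 2 := by
    rw [hD, integral_add (integrable_inv_one_add_sq.const_mul _) (hTi.const_mul _),
      integral_const_mul, integral_const_mul, integral_univ_inv_one_add_sq, hTeq]
  -- pointwise domination
  have hpt : ∀ x : ℝ, ‖g (x + y * I) / ((x : ℂ) + y * I + I)‖ ^ 2 ≤ D x := by
    intro x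
    set A : ℝ := y / π * ∫ t : ℝ, ‖b t‖ / ((t - x) ^ 2 + y ^ 2) with hA
    set A₂ : ℝ := y / π * ∫ t : ℝ, ‖b t‖ ^ 2 / ((t - x) ^ 2 + y ^ 2) with hA₂
    have h1 : ‖g (x + y * I)‖ ≤ 1 + A := norm_le_one_add_poisson_of_logMajorant hP hb x hy
    have h2 : A ^ 2 ≤ A₂ := sq_poisson_norm_le hb x hy
    have hA0 : 0 ≤ A := mul_nonneg (div_pos hy Real.pi_pos).le
      (integral_nonneg fun t ↦ div_nonneg (norm_nonneg _) (qpos x hy.ne' t).le)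
    have hden : ‖(x : ℂ) + y * I + I‖ ^ 2 = x ^ 2 + (y + 1) ^ 2 := norm_sq_den x y
    have hden1 : 1 + x ^ 2 ≤ x ^ 2 + (y + 1) ^ 2 := by nlinarith
    have hden0 : 0 < x ^ 2 + (y + 1) ^ 2 := by positivity
    rw [norm_div, div_pow, hden]
    have hnum : ‖g (x + y * I)‖ ^ 2 ≤ 2 + 2 * A₂ := by
      have : ‖g (x + y * I)‖ ^ 2 ≤ (1 + A) ^ 2 :=
        pow_le_pow_left₀ (norm_nonneg _) h1 2
      nlinarith [sq_nonneg (1 - A), h2, this]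
    have hA₂0 : 0 ≤ A₂ := le_trans (sq_nonneg _) h2
    calc ‖g (x + y * I)‖ ^ 2 / (x ^ 2 + (y + 1) ^ 2)
        ≤ (2 + 2 * A₂) / (x ^ 2 + (y + 1) ^ 2) := div_le_div_of_nonneg_right hnum hden0.le
      _ = 2 / (x ^ 2 + (y + 1) ^ 2) + 2 * A₂ / (x ^ 2 + (y + 1) ^ 2) := by rw [add_div]
      _ ≤ 2 * (1 + x ^ 2)⁻¹ + 2 * A₂ := by
          gcongr
          · rw [div_eq_mul_inv]
            exact mul_le_mul_of_nonneg_left (inv_anti₀ (by positivity) hden1) zero_le_two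
          · rw [div_le_iff₀ hden0]
            have : 1 ≤ x ^ 2 + (y + 1) ^ 2 := by nlinarith
            nlinarith
  -- measurability: continuity along the line
  have hG : DifferentiableOn ℂ (fun z : ℂ ↦ g z / (z + I)) {z : ℂ | 0 < z.im} := by
    refine hg.div (by fun_prop) fun z hz ↦ ?_
    have hz' : 0 < z.im := hz
    intro h
    have := congrArg Complex.im h
    simp at this
    linarith
  have hcont : Continuous fun x : ℝ ↦ ‖g (x + y * I) / ((x : ℂ) + y * I + I)‖ ^ 2 :=
    ((continuous_line_of_differentiableOn hG hy).norm).pow 2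
  have hInt : Integrable (fun x : ℝ ↦ ‖g (x + y * I) / ((x : ℂ) + y * I + I)‖ ^ 2) :=
    hDi.mono' hcont.aestronglyMeasurable (ae_of_all _ fun x ↦ by
      rw [Real.norm_of_nonneg (by positivity)]; exact hpt x)
  exact ⟨hInt, hDint ▸ integral_mono hInt hDi hpt⟩

end Hardy

/-! ## C. Boundary limits: a.e. convergence with an `L²` bound passes under `∫ · k` for `k ∈ L²` -/

section WeakLimit

/-- For `f ∈ L²` with `∫‖f‖² ≤ M²` (`M ≥ 0`): `‖f‖_{L²} ≤ M` as an `ℝ≥0∞` inequality. [folklore] -/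
private theorem eLpNorm_two_le_ofReal {f : ℝ → ℂ} (hf : AEStronglyMeasurable f volume)
    (hfi : Integrable fun x : ℝ ↦ ‖f x‖ ^ 2) {M : ℝ} (hM0 : 0 ≤ M)
    (hM : ∫ x : ℝ, ‖f x‖ ^ 2 ≤ M ^ 2) : eLpNorm f 2 volume ≤ ENNReal.ofReal M := by
  have hmem : MemLp f 2 volume := (memLp_two_iff_integrable_sq_norm hf).2 hfi
  rw [hmem.eLpNorm_eq_integral_rpow_norm two_ne_zero ENNReal.ofNat_ne_top]
  refine ENNReal.ofReal_le_ofReal ?_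
  simp only [ENNReal.toReal_ofNat, Real.rpow_two]
  rw [← one_div, ← Real.sqrt_eq_rpow]
  calc √(∫ x : ℝ, ‖f x‖ ^ 2) ≤ √(M ^ 2) := Real.sqrt_le_sqrt hM
    _ = M := Real.sqrt_sq hM0

/-- Hölder for an indicator: `‖1_s · f · k‖_{L¹} ≤ ‖f‖_{L²} ‖1_s k‖_{L²}`. [folklore] -/
private theorem eLpNorm_indicator_mul_le {f k : ℝ → ℂ} (hf : AEStronglyMeasurable f volume)
    (hk : AEStronglyMeasurable k volume) (s : Set ℝ) (hs : MeasurableSet s) :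
    eLpNorm (s.indicator fun x : ℝ ↦ f x * k x) 1 volume
      ≤ eLpNorm f 2 volume * eLpNorm (s.indicator k) 2 volume := by
  have e : (s.indicator fun x : ℝ ↦ f x * k x) = f • s.indicator k := by
    funext x
    rw [Set.indicator_mul_right, Pi.smul_apply', smul_eq_mul]
  rw [e]
  exact eLpNorm_smul_le_mul_eLpNorm (hk.indicator hs) hf

/-- **Passing to the limit under `∫ · k`.** If `f_n → f₀` almost everywhere on `ℝ`, the `f_n` are
uniformly bounded in `L²` (`∫‖f_n‖² ≤ M²`), `f₀ ∈ L²` and `k ∈ L²`, then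
`∫ f_n k → ∫ f₀ k` (Vitali's convergence theorem for the uniformly integrable, tight family
`f_n k`). [folklore] -/
private theorem tendsto_integral_mul_of_norm_sq_le {f : ℕ → ℝ → ℂ} {f₀ k : ℝ → ℂ} {M : ℝ}
    (hf : ∀ n, AEStronglyMeasurable (f n) volume)
    (hfi : ∀ n, Integrable fun x : ℝ ↦ ‖f n x‖ ^ 2) (hM0 : 0 ≤ M)
    (hM : ∀ n, ∫ x : ℝ, ‖f n x‖ ^ 2 ≤ M ^ 2)
    (hf₀ : MemLp f₀ 2 volume) (hk : MemLp k 2 volume)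
    (hlim : ∀ᵐ x : ℝ, Tendsto (fun n ↦ f n x) atTop (𝓝 (f₀ x))) :
    Tendsto (fun n ↦ ∫ x : ℝ, f n x * k x) atTop (𝓝 (∫ x : ℝ, f₀ x * k x)) := by
  have hfn2 : ∀ n, MemLp (f n) 2 volume := fun n ↦ (memLp_two_iff_integrable_sq_norm (hf n)).2 (hfi n)
  have hbd : ∀ n, eLpNorm (f n) 2 volume ≤ ENNReal.ofReal M :=
    fun n ↦ eLpNorm_two_le_ofReal (hf n) (hfi n) hM0 (hM n)
  have hprod : ∀ n, MemLp (fun x : ℝ ↦ f n x * k x) 1 volume := fun n ↦ hk.mul' (hfn2 n)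
  have hprod₀ : MemLp (fun x : ℝ ↦ f₀ x * k x) 1 volume := hk.mul' hf₀
  have hM1 : 0 < M + 1 := by linarith
  -- uniform integrability
  have hui : UnifIntegrable (fun n (x : ℝ) ↦ f n x * k x) 1 volume := by
    intro ε hε
    obtain ⟨δ, hδ, hδk⟩ := hk.eLpNorm_indicator_le one_le_two ENNReal.ofNat_ne_top
      (div_pos hε hM1)
    refine ⟨δ, hδ, fun n s hs hμs ↦ ?_⟩
    calc eLpNorm (s.indicator fun x : ℝ ↦ f n x * k x) 1 volume
        ≤ eLpNorm (f n) 2 volume * eLpNorm (s.indicator k) 2 volume :=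
          eLpNorm_indicator_mul_le (hf n) hk.1 s hs
      _ ≤ ENNReal.ofReal M * ENNReal.ofReal (ε / (M + 1)) := mul_le_mul' (hbd n) (hδk s hs hμs)
      _ = ENNReal.ofReal (M * (ε / (M + 1))) := (ENNReal.ofReal_mul hM0).symm
      _ ≤ ENNReal.ofReal ε := by
          refine ENNReal.ofReal_le_ofReal ?_
          rw [mul_div_assoc']
          rw [div_le_iff₀ hM1]
          nlinarith
  -- tightness
  have hut : UnifTight (fun n (x : ℝ) ↦ f n x * k x) 1 volume := by
    intro ε hε
    have hη : ENNReal.ofReal ((ε : ℝ) / (M + 1)) ≠ 0 :=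
      (ENNReal.ofReal_pos.2 (div_pos (by exact_mod_cast hε) hM1)).ne'
    obtain ⟨s, hs, hμs, hsk⟩ := hk.exists_eLpNorm_indicator_compl_lt ENNReal.ofNat_ne_top hη
    refine ⟨s, hμs.ne, fun n ↦ ?_⟩
    calc eLpNorm (sᶜ.indicator fun x : ℝ ↦ f n x * k x) 1 volume
        ≤ eLpNorm (f n) 2 volume * eLpNorm (sᶜ.indicator k) 2 volume :=
          eLpNorm_indicator_mul_le (hf n) hk.1 sᶜ hs.compl
      _ ≤ ENNReal.ofReal M * ENNReal.ofReal ((ε : ℝ) / (M + 1)) := mul_le_mul' (hbd n) hsk.le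
      _ = ENNReal.ofReal (M * ((ε : ℝ) / (M + 1))) := (ENNReal.ofReal_mul hM0).symm
      _ ≤ ENNReal.ofReal (ε : ℝ) := by
          refine ENNReal.ofReal_le_ofReal ?_
          rw [mul_div_assoc', div_le_iff₀ hM1]
          have : (0 : ℝ) ≤ ε := ε.coe_nonneg
          nlinarith
      _ = ε := ENNReal.ofReal_coe_nnreal
  -- a.e. convergence of the products
  have hfg : ∀ᵐ x : ℝ, Tendsto (fun n ↦ f n x * k x) atTop (𝓝 (f₀ x * k x)) :=
    hlim.mono fun x hx ↦ hx.mul tendsto_const_nhds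
  have hV := tendsto_Lp_of_tendsto_ae (μ := volume) le_rfl ENNReal.one_ne_top
    (f := fun n (x : ℝ) ↦ f n x * k x) (g := fun x ↦ f₀ x * k x)
    (fun n ↦ (hprod n).1) hprod₀ hui hut hfg
  exact tendsto_integral_of_L1' (fun x ↦ f₀ x * k x) hprod₀.1
    (Eventually.of_forall fun n ↦ memLp_one_iff_integrable.1 (hprod n)) hV

end WeakLimit

/-! ## D. The Cauchy representation from the Poisson log-majorant and `L²` boundary values -/

section Cauchy

variable {g : ℂ → ℂ}

/-- The open upper half-plane is open. [folklore] -/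
private theorem isOpen_uhp : IsOpen {z : ℂ | 0 < z.im} := isOpen_lt continuous_const Complex.continuous_im

/-- `t + i ≠ 0` for real `t`. [folklore] -/
private theorem ofReal_add_I_ne_zero (t : ℝ) : (t : ℂ) + I ≠ 0 := by
  intro h
  have := congrArg Complex.im h
  simp at this

/-- `t − c ≠ 0` for real `t` and non-real `c`. [folklore] -/
private theorem ofReal_sub_ne_zero' {c : ℂ} (hc : c.im ≠ 0) (t : ℝ) : (t : ℂ) - c ≠ 0 := by
  intro h
  have := congrArg Complex.im h
  simp at this
  exact hc this

/-- `z ↦ g(z)/(z + i)` is holomorphic on the open upper half-plane when `g` is. [folklore] -/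
private theorem differentiableOn_div_add_I (hg : DifferentiableOn ℂ g {z : ℂ | 0 < z.im}) :
    DifferentiableOn ℂ (fun z : ℂ ↦ g z / (z + I)) {z : ℂ | 0 < z.im} := by
  refine hg.div (by fun_prop) fun z hz ↦ ?_
  have hz' : 0 < z.im := hz
  intro h
  have := congrArg Complex.im h
  simp at this
  linarith

/-- `t ↦ (t − c)⁻¹ ∈ L²(ℝ)` for non-real `c`. [folklore] -/
private theorem memLp_two_inv_ofReal_sub {c : ℂ} (hc : c.im ≠ 0) :
    MemLp (fun t : ℝ ↦ ((t : ℂ) - c)⁻¹) 2 volume := by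
  have hcont : Continuous fun t : ℝ ↦ ((t : ℂ) - c)⁻¹ :=
    (continuous_ofReal.sub continuous_const).inv₀ (ofReal_sub_ne_zero' hc)
  exact (memLp_two_iff_integrable_sq_norm hcont.aestronglyMeasurable).2
    (integrable_norm_inv_ofReal_sub_sq hc)

/-- For `b ∈ L²(ℝ)`: `∫ b(t)/(t + iR) dt → 0` as `R = n + 2 → ∞` (dominated convergence, dominant
`‖b(t)‖/|t + i|`). [folklore] -/
private theorem tendsto_integral_div_add_mul_I {b : ℝ → ℂ} (hb : MemLp b 2 volume) :
    Tendsto (fun n : ℕ ↦ ∫ t : ℝ, b t / ((t : ℂ) + ((n : ℝ) + 2 : ℝ) * I)) atTop (𝓝 0) := by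
  have hb2 : Integrable fun t : ℝ ↦ ‖b t‖ ^ 2 := (memLp_two_iff_integrable_sq_norm hb.1).1 hb
  -- the dominant `‖b t‖ ‖(t + i)⁻¹‖`
  have hI : (-I).im ≠ 0 := by simp
  have hdom : Integrable fun t : ℝ ↦ ‖b t‖ * ‖((t : ℂ) + I)⁻¹‖ := by
    have h := (integrable_div_ofReal_sub hb.1 hb2 hI).norm
    refine h.congr (ae_of_all _ fun t ↦ ?_)
    simp [div_eq_mul_inv]
  rw [← integral_zero ℝ ℂ]
  refine tendsto_integral_of_dominated_convergence (fun t : ℝ ↦ ‖b t‖ * ‖((t : ℂ) + I)⁻¹‖)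
    (fun n ↦ ?_) hdom (fun n ↦ ae_of_all _ fun t ↦ ?_) (ae_of_all _ fun t ↦ ?_)
  · -- measurability
    have hn2 : (0 : ℝ) < (n : ℝ) + 2 := by positivity
    have hR : (-((((n : ℝ) + 2 : ℝ) : ℂ) * I)).im ≠ 0 := by
      rw [neg_im, Complex.mul_im, Complex.ofReal_re, Complex.ofReal_im, Complex.I_re,
        Complex.I_im]
      simp only [mul_zero, mul_one, add_zero, ne_eq, neg_eq_zero]
      exact hn2.ne'
    have h := (integrable_div_ofReal_sub hb.1 hb2 hR).1
    refine h.congr (ae_of_all _ fun t ↦ ?_)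
    simp only [sub_neg_eq_add]
  · -- domination: `|t + iR| ≥ |t + i|` for `R ≥ 1`
    rw [norm_div, div_eq_mul_inv, ← norm_inv]
    refine mul_le_mul_of_nonneg_left ?_ (norm_nonneg _)
    rw [norm_inv, norm_inv]
    have h1 : ‖(t : ℂ) + I‖ ≤ ‖(t : ℂ) + (((n : ℝ) + 2 : ℝ) : ℂ) * I‖ := by
      have e1 : ‖(t : ℂ) + I‖ ^ 2 = t ^ 2 + 1 := by
        rw [← Complex.normSq_eq_norm_sq, Complex.normSq_apply]; simp; ring
      have e2 : ‖(t : ℂ) + (((n : ℝ) + 2 : ℝ) : ℂ) * I‖ ^ 2 = t ^ 2 + ((n : ℝ) + 2) ^ 2 := by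
        rw [← Complex.normSq_eq_norm_sq, Complex.normSq_apply]; simp; ring
      have hn : (0 : ℝ) ≤ n := n.cast_nonneg
      exact (pow_le_pow_iff_left₀ (norm_nonneg _) (norm_nonneg _) two_ne_zero).1
        (by rw [e1, e2]; nlinarith)
    have h0 : 0 < ‖(t : ℂ) + I‖ := norm_pos_iff.2 (ofReal_add_I_ne_zero t)
    exact inv_anti₀ h0 h1
  · -- pointwise limit `0`: `‖b t‖/|t + iR| ≤ ‖b t‖/R → 0`
    rw [tendsto_zero_iff_norm_tendsto_zero]
    have hR : Tendsto (fun n : ℕ ↦ ‖b t‖ / ((n : ℝ) + 2)) atTop (𝓝 0) := by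
      have h1 : Tendsto (fun n : ℕ ↦ (n : ℝ) + 2) atTop atTop :=
        tendsto_atTop_add_const_right _ _ tendsto_natCast_atTop_atTop
      exact tendsto_const_nhds.div_atTop h1
    refine squeeze_zero (fun n ↦ norm_nonneg _) (fun n ↦ ?_) hR
    rw [norm_div]
    have hn : (0 : ℝ) < (n : ℝ) + 2 := by positivity
    refine div_le_div_of_nonneg_left (norm_nonneg _) hn ?_
    have : |((t : ℂ) + (((n : ℝ) + 2 : ℝ) : ℂ) * I).im| ≤ ‖(t : ℂ) + (((n : ℝ) + 2 : ℝ) : ℂ) * I‖ :=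
      Complex.abs_im_le_norm _
    simpa [abs_of_pos hn] using this

/-- **Cauchy representation from the Poisson log-majorant.** Let `g` be holomorphic on the open
upper half-plane, with vertical boundary values `b = bdryValue g` almost everywhere
(`HasBdryValues g`), `b ∈ L²(ℝ)`, and satisfying Conrey–Li's membership inequality
`log|g(x+iy)| ≤ (y/π)∫ log|b(t)| dt/((t−x)²+y²)` (`HasPoissonLogMajorant g`). Then
`∫ b(t)/(t − w) dt = 2πi g(w)` for `Im w > 0` and `∫ b(t)/(t − a) dt = 0` for `Im a < 0` — the
Cauchy formula behind Conrey–Li's (2.6). Proof: `G = g/(z+i) ∈ H²` (`hardy_bound_of_logMajorant`),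
Cauchy's formula for the boundary-regular translates `G(· + iε)` (tree `HalfPlaneCauchy`), the
limit `ε → 0⁺` by Vitali along the a.e. vertical limits, and partial fractions; the bounded-type
clause of the printed definition is not needed. [cite: ConreyLi2000, §2 (2.6)] -/
theorem cauchy_integral_of_logMajorant (hg : DifferentiableOn ℂ g {z : ℂ | 0 < z.im})
    (hbv : HasBdryValues g) (hb : MemLp (bdryValue g) 2 volume) (hP : HasPoissonLogMajorant g) :
    (∀ w : ℂ, 0 < w.im → ∫ t : ℝ, bdryValue g t / ((t : ℂ) - w) = 2 * π * I * g w) ∧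
      ∀ a : ℂ, a.im < 0 → ∫ t : ℝ, bdryValue g t / ((t : ℂ) - a) = 0 := by
  set b := bdryValue g with hbdef
  have hb2 : Integrable fun t : ℝ ↦ ‖b t‖ ^ 2 := (memLp_two_iff_integrable_sq_norm hb.1).1 hb
  -- `G = g/(z + i)` and its Hardy bound
  set G : ℂ → ℂ := fun z ↦ g z / (z + I) with hGdef
  have hGd : DifferentiableOn ℂ G {z : ℂ | 0 < z.im} := differentiableOn_div_add_I hg
  set M : ℝ := Real.sqrt (2 * π + 2 * ∫ t : ℝ, ‖b t‖ ^ 2) with hM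
  have hM0 : 0 ≤ M := Real.sqrt_nonneg _
  have h2 : ∀ y : ℝ, 0 < y → Integrable (fun x : ℝ ↦ ‖G (x + y * I)‖ ^ 2) :=
    fun y hy ↦ (hardy_bound_of_logMajorant hg hP hb hy).1
  have hMb : ∀ y : ℝ, 0 < y → ∫ x : ℝ, ‖G (x + y * I)‖ ^ 2 ≤ M ^ 2 := by
    intro y hy
    rw [hM, Real.sq_sqrt (by positivity)]
    exact (hardy_bound_of_logMajorant hg hP hb hy).2
  -- Cauchy's formulas for the translates `G(· + iε)`
  have hC : ∀ ε : ℝ, 0 < ε →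
      (∀ w : ℂ, 0 < w.im → ∫ x : ℝ, G (x + ε * I) / ((x : ℂ) - w) = 2 * π * I * G (w + ε * I)) ∧
      (∀ a : ℂ, a.im < 0 → ∫ x : ℝ, G (x + ε * I) / ((x : ℂ) - a) = 0) := by
    intro ε hε
    obtain ⟨hd, hi, hbd⟩ := translate_hypotheses_of_hardy hGd h2 hMb hM0 hε
    have hCpos : (0 : ℝ) ≤ 2 * M / √π := by positivity
    exact ⟨fun w hw ↦ integral_div_sub_eq_of_im_pos (R₀ := 0) hCpos hd hi hbd hw,
      fun a ha ↦ integral_div_sub_eq_zero_of_im_neg (R₀ := 0) hCpos hd hi hbd ha⟩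
  -- the sequence `ε_n = 1/(n+1) → 0⁺`
  set ε : ℕ → ℝ := fun n ↦ 1 / ((n : ℝ) + 1) with hε
  have hεpos : ∀ n, 0 < ε n := fun n ↦ by
    show 0 < 1 / ((n : ℝ) + 1)
    positivity
  have hεlim : Tendsto ε atTop (𝓝 0) := tendsto_one_div_add_atTop_nhds_zero_nat
  have hεlim' : Tendsto ε atTop (𝓝[>] 0) :=
    tendsto_nhdsWithin_iff.2 ⟨hεlim, Eventually.of_forall hεpos⟩
  have hεC : Tendsto (fun n ↦ ((ε n : ℝ) : ℂ) * I) atTop (𝓝 0) := by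
    have h := (continuous_ofReal.tendsto 0).comp hεlim
    have : Tendsto (fun n ↦ ((ε n : ℝ) : ℂ) * I) atTop (𝓝 (((0 : ℝ) : ℂ) * I)) :=
      h.mul tendsto_const_nhds
    simpa using this
  -- the boundary function `β = b/(t + i)` of `G`
  have hβm : AEStronglyMeasurable (fun t : ℝ ↦ b t / ((t : ℂ) + I)) volume := by
    have hcont : Continuous fun t : ℝ ↦ ((t : ℂ) + I)⁻¹ :=
      (continuous_ofReal.add continuous_const).inv₀ ofReal_add_I_ne_zero
    exact (hb.1.mul hcont.aestronglyMeasurable).congr (ae_of_all _ fun t ↦ by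
      simp [div_eq_mul_inv])
  have hβ : MemLp (fun t : ℝ ↦ b t / ((t : ℂ) + I)) 2 volume := by
    rw [memLp_two_iff_integrable_sq_norm hβm]
    refine hb2.mono' (hβm.norm.pow 2) (ae_of_all _ fun t ↦ ?_)
    rw [Real.norm_of_nonneg (by positivity), norm_div]
    have h1 : 1 ≤ ‖(t : ℂ) + I‖ := by
      have : |((t : ℂ) + I).im| ≤ ‖(t : ℂ) + I‖ := Complex.abs_im_le_norm _
      simpa using this
    rw [div_pow]
    exact div_le_self (sq_nonneg _) (one_le_pow₀ h1)
  -- a.e. vertical limits of `G`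
  have hlimG : ∀ᵐ t : ℝ, Tendsto (fun n ↦ G (t + ε n * I)) atTop (𝓝 (b t / ((t : ℂ) + I))) := by
    filter_upwards [hbv] with t ht
    have h1 : Tendsto (fun n ↦ g (t + ε n * I)) atTop (𝓝 (b t)) := ht.comp hεlim'
    have h2 : Tendsto (fun n ↦ (t : ℂ) + ε n * I + I) atTop (𝓝 ((t : ℂ) + I)) := by
      have : Tendsto (fun n ↦ (t : ℂ) + ((ε n : ℝ) : ℂ) * I + I) atTop (𝓝 ((t : ℂ) + 0 + I)) :=
        (tendsto_const_nhds.add hεC).add tendsto_const_nhds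
      simpa using this
    exact h1.div h2 (ofReal_add_I_ne_zero t)
  -- the weak limit against `(t − c)⁻¹`
  have hlimI : ∀ c : ℂ, c.im ≠ 0 → Tendsto (fun n ↦ ∫ t : ℝ, G (t + ε n * I) * ((t : ℂ) - c)⁻¹)
      atTop (𝓝 (∫ t : ℝ, b t / ((t : ℂ) + I) * ((t : ℂ) - c)⁻¹)) := by
    intro c hc
    refine tendsto_integral_mul_of_norm_sq_le (f := fun n (t : ℝ) ↦ G (t + ε n * I))
      (fun n ↦ ?_) (fun n ↦ h2 (ε n) (hεpos n)) hM0 (fun n ↦ hMb (ε n) (hεpos n)) hβ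
      (memLp_two_inv_ofReal_sub hc) hlimG
    exact (continuous_line_of_differentiableOn hGd (hεpos n)).aestronglyMeasurable
  -- upper half-plane: `∫ β/(t − w) = 2πi G(w)`
  have hup : ∀ w : ℂ, 0 < w.im →
      ∫ t : ℝ, b t / ((t : ℂ) + I) * ((t : ℂ) - w)⁻¹ = 2 * π * I * G w := by
    intro w hw
    have hseq : (fun n ↦ ∫ t : ℝ, G (t + ε n * I) * ((t : ℂ) - w)⁻¹)
        = fun n ↦ 2 * π * I * G (w + ε n * I) := by
      funext n
      rw [← ((hC (ε n) (hεpos n)).1 w hw)]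
      simp_rw [div_eq_mul_inv]
    have hGc : Tendsto (fun n ↦ 2 * π * I * G (w + ε n * I)) atTop (𝓝 (2 * π * I * G w)) := by
      have hcont : ContinuousAt G w := (hGd.differentiableAt (isOpen_uhp.mem_nhds hw)).continuousAt
      have hpath : Tendsto (fun n ↦ w + ε n * I) atTop (𝓝 w) := by
        have : Tendsto (fun n ↦ w + ((ε n : ℝ) : ℂ) * I) atTop (𝓝 (w + 0)) :=
          tendsto_const_nhds.add hεC
        simpa using this
      exact tendsto_const_nhds.mul (hcont.tendsto.comp hpath)
    have h := hlimI w hw.ne'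
    rw [hseq] at h
    exact tendsto_nhds_unique h hGc
  -- lower half-plane: `∫ β/(t − a) = 0`
  have hdown : ∀ a : ℂ, a.im < 0 → ∫ t : ℝ, b t / ((t : ℂ) + I) * ((t : ℂ) - a)⁻¹ = 0 := by
    intro a ha
    have hseq : (fun n ↦ ∫ t : ℝ, G (t + ε n * I) * ((t : ℂ) - a)⁻¹) = fun _ ↦ (0 : ℂ) := by
      funext n
      rw [← ((hC (ε n) (hεpos n)).2 a ha)]
      simp_rw [div_eq_mul_inv]
    have h := hlimI a ha.ne
    rw [hseq] at h
    exact tendsto_nhds_unique h tendsto_const_nhds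
  -- partial fractions
  have hIb : ∀ c : ℂ, c.im ≠ 0 → Integrable fun t : ℝ ↦ b t / ((t : ℂ) - c) :=
    fun c hc ↦ integrable_div_ofReal_sub hb.1 hb2 hc
  have hIbI : Integrable fun t : ℝ ↦ b t / ((t : ℂ) + I) := by
    have := hIb (-I) (by simp)
    simpa [sub_neg_eq_add] using this
  set c₀ : ℂ := ∫ t : ℝ, b t / ((t : ℂ) + I) with hc₀
  have hpf : ∀ c : ℂ, c.im ≠ 0 → c + I ≠ 0 →
      ∫ t : ℝ, b t / ((t : ℂ) + I) * ((t : ℂ) - c)⁻¹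
        = (c + I)⁻¹ * ((∫ t : ℝ, b t / ((t : ℂ) - c)) - c₀) := by
    intro c hc hcI
    have hpt : ∀ t : ℝ, b t / ((t : ℂ) + I) * ((t : ℂ) - c)⁻¹
        = (c + I)⁻¹ * (b t / ((t : ℂ) - c) - b t / ((t : ℂ) + I)) := by
      intro t
      have h1 := ofReal_add_I_ne_zero t
      have h2 := ofReal_sub_ne_zero' hc t
      field_simp
      ring
    simp_rw [hpt]
    rw [integral_const_mul, integral_sub (hIb c hc) hIbI]
  -- the constant `c₀ = ∫ b/(t + i)` vanishes: it equals `∫ b/(t + iR)` for every `R ≥ 2`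
  have hc₀R : ∀ n : ℕ, ∫ t : ℝ, b t / ((t : ℂ) + (((n : ℝ) + 2 : ℝ) : ℂ) * I) = c₀ := by
    intro n
    set a : ℂ := -((((n : ℝ) + 2 : ℝ) : ℂ) * I) with ha
    have hn2 : (0 : ℝ) < (n : ℝ) + 2 := by positivity
    have haim_eq : a.im = -((n : ℝ) + 2) := by
      rw [ha, neg_im, Complex.mul_im, Complex.ofReal_re, Complex.ofReal_im, Complex.I_re,
        Complex.I_im]
      ring
    have haim : a.im < 0 := by rw [haim_eq]; linarith
    have haI : a + I ≠ 0 := by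
      intro h
      have := congrArg Complex.im h
      rw [add_im, haim_eq, Complex.I_im, Complex.zero_im] at this
      linarith
    have h := hpf a haim.ne haI
    rw [hdown a haim] at h
    have h' : (∫ t : ℝ, b t / ((t : ℂ) - a)) - c₀ = 0 := by
      have := (mul_eq_zero.1 h.symm).resolve_left (inv_ne_zero haI)
      exact this
    rw [sub_eq_zero] at h'
    rw [← h', ha]
    simp_rw [sub_neg_eq_add]
  have hc₀0 : c₀ = 0 := by
    have h := tendsto_integral_div_add_mul_I hb
    rw [show (fun n : ℕ ↦ ∫ t : ℝ, b t / ((t : ℂ) + (((n : ℝ) + 2 : ℝ) : ℂ) * I)) = fun _ ↦ c₀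
      from funext hc₀R] at h
    exact tendsto_nhds_unique tendsto_const_nhds h
  refine ⟨fun w hw ↦ ?_, fun a ha ↦ ?_⟩
  · -- `Im w > 0`
    have hwI : w + I ≠ 0 := by
      intro h
      have := congrArg Complex.im h
      simp at this
      linarith
    have h := hpf w hw.ne' hwI
    rw [hup w hw, hc₀0, sub_zero] at h
    -- `2πi G(w) = (w + i)⁻¹ ∫ b/(t − w)` with `G(w) = g(w)/(w + i)`
    have hG : G w = g w / (w + I) := rfl
    rw [hG] at h
    have h' : (w + I) * (2 * π * I * (g w / (w + I)))
        = (w + I) * ((w + I)⁻¹ * ∫ t : ℝ, b t / ((t : ℂ) - w)) := congrArg (fun z ↦ (w + I) * z) h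
    rw [← mul_assoc (w + I) (w + I)⁻¹, mul_inv_cancel₀ hwI, one_mul] at h'
    rw [← h', mul_comm, mul_assoc, div_mul_cancel₀ _ hwI]
  · -- `Im a < 0`
    by_cases haI : a + I = 0
    · have : a = -I := eq_neg_of_add_eq_zero_left haI
      rw [this]
      simp_rw [sub_neg_eq_add]
      exact hc₀0
    · have h := hpf a ha.ne haI
      rw [hdown a ha, hc₀0, sub_zero] at h
      exact ((mul_eq_zero.1 h.symm).resolve_left (inv_ne_zero haI))

end Cauchy

/-! ## E. Conrey–Li (2.6): the kernel `K(w, ·)` reproduces every element of `𝓕(W)` -/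

namespace SpaceF

variable {W : ℂ → ℂ}

/-- **Cauchy representation of the elements of `𝓕(W)`.** For `W` analytic and zero-free on the
open upper half-plane and `F ∈ 𝓕(W)` (`SpaceF.Mem W F`, Conrey–Li's definition as typed), with
`b = bdryValue (F/W)` the boundary function of `F/W`:
`∫ b(t)/(t − w) dt = 2πi F(w)/W(w)` for `Im w > 0` and `∫ b(t)/(t − a) dt = 0` for `Im a < 0`.
[cite: ConreyLi2000, §2 (2.6)] -/
theorem cauchy_integral_of_mem (hW : DifferentiableOn ℂ W {z : ℂ | 0 < z.im})
    (hW0 : ∀ z : ℂ, 0 < z.im → W z ≠ 0) {F : ℂ → ℂ} (hF : Mem W F) :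
    (∀ w : ℂ, 0 < w.im →
      ∫ t : ℝ, bdryValue (fun z ↦ F z / W z) t / ((t : ℂ) - w) = 2 * π * I * (F w / W w)) ∧
      ∀ a : ℂ, a.im < 0 → ∫ t : ℝ, bdryValue (fun z ↦ F z / W z) t / ((t : ℂ) - a) = 0 := by
  obtain ⟨hFd, -, hbv, hL2, hP⟩ := hF
  have hg : DifferentiableOn ℂ (fun z ↦ F z / W z) {z : ℂ | 0 < z.im} := hFd.div hW hW0
  exact cauchy_integral_of_logMajorant hg hbv hL2 hP

/-- **Conrey–Li 2000, (2.6): `F(w) = ⟨F(z), K(w, z)⟩_{𝓕(W)}` for every element `F ∈ 𝓕(W)` and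
every `w` in the upper half-plane — PROVED for the space `𝓕(W)` as typed** (`SpaceF.Mem`,
`SpaceF.inner`, `SpaceF.kernel` of `ConreyLi2000SpacesFW.lean`; `W` analytic and zero-free on the
open upper half-plane). The boundary function of `K(w,·)/W` is `conj W(w)/(2πi(w̄ − t))`
(`bdryValue_eq_of_eqOn_q`), so `⟨F, K(w,·)⟩ = (W(w)/2πi) ∫ b_{F/W}(t)/(t − w) dt = W(w)·(F/W)(w)`
by the Cauchy representation `cauchy_integral_of_mem`. (The printed text states (2.6) as the
defining property of the reproducing kernel; here it is a theorem about the printed membership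
conditions, the bounded-type clause not being needed.) [cite: ConreyLi2000, §2 (2.6)] -/
theorem inner_kernel_eq_apply (hW : DifferentiableOn ℂ W {z : ℂ | 0 < z.im})
    (hW0 : ∀ z : ℂ, 0 < z.im → W z ≠ 0) {F : ℂ → ℂ} (hF : Mem W F) {w : ℂ} (hw : 0 < w.im) :
    inner W F (kernel W w) = F w := by
  have hWw : W w ≠ 0 := hW0 w hw
  have hC := (cauchy_integral_of_mem hW hW0 hF).1 w hw
  -- the boundary function of `K(w,·)/W`
  have hq : ∀ z : ℂ, 0 < z.im → kernel W w z / W z = conj (W w) / (2 * π * I * (conj w - z)) :=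
    fun z hz ↦ kernel_div_eq W w (hW0 z hz)
  have hbv : bdryValue (fun z ↦ kernel W w z / W z)
      = fun x : ℝ ↦ conj (W w) / (2 * π * I * (conj w - x)) :=
    funext fun x ↦ (bdryValue_eq_of_eqOn_q hw hq x).2
  unfold inner
  rw [hbv]
  have hπ : (π : ℂ) ≠ 0 := ofReal_ne_zero.2 Real.pi_ne_zero
  have hxw : ∀ x : ℝ, (x : ℂ) - w ≠ 0 := fun x h ↦ by
    have := congrArg Complex.im h; simp at this; linarith
  have hpt : ∀ x : ℝ,
      bdryValue (fun z ↦ F z / W z) x * conj (conj (W w) / (2 * π * I * (conj w - x)))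
        = W w / (2 * π * I) * (bdryValue (fun z ↦ F z / W z) x / ((x : ℂ) - w)) := by
    intro x
    have e1 : conj (conj (W w) / (2 * π * I * (conj w - x))) = W w / (2 * π * I * ((x : ℂ) - w)) := by
      simp only [map_div₀, map_mul, map_sub, Complex.conj_conj, Complex.conj_ofReal, Complex.conj_I,
        map_ofNat]
      have : 2 * (π : ℂ) * -I * (w - x) = 2 * π * I * ((x : ℂ) - w) := by ring
      rw [this]
    rw [e1]
    have h1 := hxw x
    field_simp
  simp_rw [hpt]
  rw [integral_const_mul, hC]
  field_simp

/-- **Pointwise evaluation as a Cauchy integral**: for `F ∈ 𝓕(W)` and `Im w > 0`,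
`F(w) = (W(w)/2πi) ∫ b_{F/W}(t)/(t − w) dt`. [cite: ConreyLi2000, §2 (2.6)] -/
theorem apply_eq_cauchy_integral (hW : DifferentiableOn ℂ W {z : ℂ | 0 < z.im})
    (hW0 : ∀ z : ℂ, 0 < z.im → W z ≠ 0) {F : ℂ → ℂ} (hF : Mem W F) {w : ℂ} (hw : 0 < w.im) :
    F w = W w / (2 * π * I) * ∫ t : ℝ, bdryValue (fun z ↦ F z / W z) t / ((t : ℂ) - w) := by
  rw [(cauchy_integral_of_mem hW hW0 hF).1 w hw]
  have hWw : W w ≠ 0 := hW0 w hw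
  have hπ : (π : ℂ) ≠ 0 := ofReal_ne_zero.2 Real.pi_ne_zero
  field_simp

/-- **The elements of `𝓕(W)` have vanishing Cauchy integrals over the lower half-plane**:
`∫ b_{F/W}(t)/(t − a) dt = 0` for `Im a < 0` (`F/W` is "analytic in the upper half-plane" in the
boundary-value sense). [cite: ConreyLi2000, §2 (2.6)] -/
theorem cauchy_integral_eq_zero_of_im_neg (hW : DifferentiableOn ℂ W {z : ℂ | 0 < z.im})
    (hW0 : ∀ z : ℂ, 0 < z.im → W z ≠ 0) {F : ℂ → ℂ} (hF : Mem W F) {a : ℂ} (ha : a.im < 0) :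
    ∫ t : ℝ, bdryValue (fun z ↦ F z / W z) t / ((t : ℂ) - a) = 0 :=
  (cauchy_integral_of_mem hW hW0 hF).2 a ha

/-- **The reproducing-kernel bound `|F(w)|² ≤ ⟨F, F⟩_{𝓕(W)} K(w, w)`** for `F ∈ 𝓕(W)`, `Im w > 0`,
in the explicit form `‖F(w)‖² ≤ (∫ ‖b_{F/W}‖²) · ‖W(w)‖²/(4π Im w)` (`K(w,w) = |W(w)|²/(4π Im w)`,
`⟨F,F⟩ = ∫‖b_{F/W}‖²` by `inner_self_eq`): Cauchy–Schwarz in the representation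
`apply_eq_cauchy_integral`, `∫ dt/|t − w|² = π/Im w`. [cite: ConreyLi2000, §2 (2.6)] -/
theorem norm_sq_apply_le (hW : DifferentiableOn ℂ W {z : ℂ | 0 < z.im})
    (hW0 : ∀ z : ℂ, 0 < z.im → W z ≠ 0) {F : ℂ → ℂ} (hF : Mem W F) {w : ℂ} (hw : 0 < w.im) :
    ‖F w‖ ^ 2 ≤ (∫ t : ℝ, ‖bdryValue (fun z ↦ F z / W z) t‖ ^ 2) * (‖W w‖ ^ 2 / (4 * π * w.im)) := by
  set b := bdryValue (fun z ↦ F z / W z) with hb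
  have hL2 : MemLp b 2 volume := hF.2.2.2.1
  have hb2 : Integrable fun t : ℝ ↦ ‖b t‖ ^ 2 := (memLp_two_iff_integrable_sq_norm hL2.1).1 hL2
  have hk2 : Integrable fun t : ℝ ↦ ‖((t : ℂ) - w)⁻¹‖ ^ 2 := integrable_norm_inv_ofReal_sub_sq hw.ne'
  -- Cauchy–Schwarz: `‖∫ b/(t−w)‖² ≤ (∫‖b‖²)(∫ |t−w|⁻²)`
  have hCS : ‖∫ t : ℝ, b t / ((t : ℂ) - w)‖ ^ 2
      ≤ (∫ t : ℝ, ‖b t‖ ^ 2) * ∫ t : ℝ, ‖((t : ℂ) - w)⁻¹‖ ^ 2 := by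
    have h1 : ‖∫ t : ℝ, b t / ((t : ℂ) - w)‖ ≤ ∫ t : ℝ, ‖b t‖ * ‖((t : ℂ) - w)⁻¹‖ := by
      refine (norm_integral_le_integral_norm _).trans_eq (integral_congr_ae (ae_of_all _ fun t ↦ ?_))
      simp [div_eq_mul_inv]
    have h2 : ∫ t : ℝ, ‖b t‖ * ‖((t : ℂ) - w)⁻¹‖
        ≤ (∫ t : ℝ, ‖b t‖ ^ (2 : ℝ)) ^ (1 / (2 : ℝ)) * (∫ t : ℝ, ‖((t : ℂ) - w)⁻¹‖ ^ (2 : ℝ)) ^ (1 / (2 : ℝ)) := by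
      refine integral_mul_le_Lp_mul_Lq_of_nonneg Real.HolderConjugate.two_two ?_ ?_ ?_ ?_
      · exact ae_of_all _ fun t ↦ norm_nonneg _
      · exact ae_of_all _ fun t ↦ norm_nonneg _
      · simpa [Real.rpow_two] using hL2.norm   -- MemLp (‖b‖) (ofReal 2)
      · simpa [Real.rpow_two] using (memLp_two_inv_ofReal_sub hw.ne').norm
    have h0 : 0 ≤ ∫ t : ℝ, ‖b t‖ * ‖((t : ℂ) - w)⁻¹‖ := integral_nonneg fun t ↦ by positivity
    have hA : 0 ≤ ∫ t : ℝ, ‖b t‖ ^ 2 := integral_nonneg fun t ↦ by positivity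
    have hB : 0 ≤ ∫ t : ℝ, ‖((t : ℂ) - w)⁻¹‖ ^ 2 := integral_nonneg fun t ↦ by positivity
    simp only [Real.rpow_two] at h2
    rw [← Real.sqrt_eq_rpow, ← Real.sqrt_eq_rpow] at h2
    calc ‖∫ t : ℝ, b t / ((t : ℂ) - w)‖ ^ 2 ≤ (∫ t : ℝ, ‖b t‖ * ‖((t : ℂ) - w)⁻¹‖) ^ 2 :=
          pow_le_pow_left₀ (norm_nonneg _) h1 2
      _ ≤ (√(∫ t : ℝ, ‖b t‖ ^ 2) * √(∫ t : ℝ, ‖((t : ℂ) - w)⁻¹‖ ^ 2)) ^ 2 :=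
          pow_le_pow_left₀ h0 h2 2
      _ = (∫ t : ℝ, ‖b t‖ ^ 2) * ∫ t : ℝ, ‖((t : ℂ) - w)⁻¹‖ ^ 2 := by
          rw [mul_pow, Real.sq_sqrt hA, Real.sq_sqrt hB]
  -- `∫ |t − w|⁻² = π/Im w`
  have hK : ∫ t : ℝ, ‖((t : ℂ) - w)⁻¹‖ ^ 2 = π / w.im := by
    have e : (fun t : ℝ ↦ ‖((t : ℂ) - w)⁻¹‖ ^ 2) = fun t ↦ ((t - w.re) ^ 2 + w.im ^ 2)⁻¹ := by
      funext t; rw [norm_inv, inv_pow, norm_ofReal_sub_sq]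
    rw [e, integral_inv_sub_sq_add_sq w.re hw]
  have hden : ‖2 * (π : ℂ) * I‖ ^ 2 = 4 * π ^ 2 := by
    rw [norm_mul, norm_mul, Complex.norm_I, mul_one, Complex.norm_real, Real.norm_eq_abs,
      abs_of_pos Real.pi_pos, Complex.norm_two]
    ring
  rw [apply_eq_cauchy_integral hW hW0 hF hw, norm_mul, mul_pow, norm_div, div_pow, hden]
  rw [hK] at hCS
  calc ‖W w‖ ^ 2 / (4 * π ^ 2) * ‖∫ t : ℝ, b t / ((t : ℂ) - w)‖ ^ 2
      ≤ ‖W w‖ ^ 2 / (4 * π ^ 2) * ((∫ t : ℝ, ‖b t‖ ^ 2) * (π / w.im)) :=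
        mul_le_mul_of_nonneg_left hCS (by positivity)
    _ = (∫ t : ℝ, ‖b t‖ ^ 2) * (‖W w‖ ^ 2 / (4 * π * w.im)) := by
        have hπ : (π : ℝ) ≠ 0 := Real.pi_ne_zero
        have hwim : w.im ≠ 0 := hw.ne'
        field_simp

end SpaceF

end Literature.Analysis.DeBrangesSpaces

end
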